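import Literature.NumberTheory.Rogawski1990.ArchEPAssemblyLocal        -- ★ (L1) p852251 (LH7-p04 (g8)): `ballIdentity_of_readings` (pure logic over ★ E3-CORE p852223)
import Literature.NumberTheory.Rogawski1990.ArchEPAssemblyBeta         -- ★ hβ p852280 (F0P2-p02 (g21)): `orbFamGExt_div_archRG_slotPerm_eq_of_tensor`
import Literature.NumberTheory.Rogawski1990.ArchEPAssemblyAlpha        -- ★ hα p852276 (LH7-p04 (g8)): `alphaReading_of_classMul` (over ★ E2b p852207 + ★ (s1) p852258)
import Literature.NumberTheory.Rogawski1990.ArchEPAssemblyGen          -- ★ hgen p852290 (F0P3a-p02 (g23)): `weightedCompactClause_letters`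
import Literature.NumberTheory.Rogawski1990.ArchEPAssemblyJunkLabel    -- ★ (s2) p852288 (LH3-p03 (g8)): `orbFamGExt_slotPerm_eq_zero_of_tensor_of_split`
import HarnessLib

/-!
# EP ASSEMBLY — THE PER-BALL IDENTITY FROM THE SLICES («(L2) §3(3) READINGS DOCK»): for ONE ball of the (12′) partition, the `β`-side stable sums of the tensor test function
# are `3^{-#D}` times the `α`-side stable sums of the class-multiplied `a′`, on EVERY label — modulo exactly the block transport `hIT` (N8-INNER ROAD B, brick (12′) E3a; Rogawski 1990 §4.1, §14.2)

Topic `NumberTheory/Rogawski1990`; namespace `Literature.NumberTheory.Rogawski1990`.  THEOREMS ONLY (no `def`, no instance, no notation, no axiom, no named fact, no `sorry`).  Cell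
`pub/hodgecm-mathlib`, crux H413 (`stmt-HodgeConjecture-24833`), F0∕P3c road «N8-INNER» ROAD B, brick (12′) «EP ASSEMBLY», HANDOFF-E3a (`F0/P3c/LH7/LH7-p04/g8/e3a/HANDOFF-E3a.LH7p04g8.md`) §3 step (3),
carved «BallIdentity YOURS» by the E3 pen of record LH3-p04 (g8) 2026-09-02T17:56:25Z; census `F0/P3c/LH3/LH3-p03/g8/bi/CENSUS-BallIdentity.v1.LH3p03g8.md`.  Seat LH3-p03 (g8).  Count-neutral.

THE MATHEMATICS.  Fix the two frames `α` (anisotropic, `D` = the block `p` of its definite places, `hp : p w ↔ w ∉ splitChartPlaces L α`) and `β` (E3a: `β₀`, every place split), both groups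
`G′_∞ = U(diag α)_∞`, `G_∞ = U(diag β)_∞` in PRODUCT-MEASURE convention (`ν′ = e_α⁻¹⁎ ⊗ ν′_w`, `νβ = e_β⁻¹⁎ ⊗ νβ_w`), an `α`-side test function `a′ ∈ C_c(G′_∞)`, and the data of ONE ball `J` of
the (12′) partition: per definite place `v`, a centre `b_v`, a radius `ε_v`, a partition factor `F_v` supported in `ball b_v ε_v` (`hFε`), an E1 generator `(f_v, h_v)` (`h_v ≠ 0` on the ball, `hh0`;
SPLIT clause `hsplit`; COMPACT clause `hcpt` — the fields of ★ E3b∕(L2) `exists_epGenerator_choice(_pi)`), the weights `mcl_v = 2F_v∕h_v` (`hmclF`), and the per-ball `β`-side test function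
`f(k) = (Π_v mcl_v(cl_v k) · f_v(k_v)) · G(cl_D k, k_I)` (`hf`, ★ §2(7) shape) with its coupling `G`.  Put `a″ := (Π_v F_v ∘ cl_v) · a′`.  CLAIM (**`ballIdentity_of_slices`**):
  `∀ S, ∀ c ∈ RegG S:  SS_β(f) S c = 3^{-#p} · SS_α(a″) S c`,
PROVIDED the block transport `hIT` («`(Π_v F_v(cl_v c)) ≠ 0 ⇒ Rβ ρ₂ = Rα ρ₂` for every `ρ₂ ∈ partnerPerms S|_{¬p}`», the `¬p`-block quotient reading of `G(cl_D c, ·)` on the `β` side versus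
the `¬p`-block quotient reading of the `U(3)^D`-average of `a′` on the `α` side — LH7-p01 (g8)'s (T1) ★ p852310 ∘ `exists_coupling`), carried here as ONE hypothesis in ★ E3-CORE's letter.
PROOF = ★ (L1) `ballIdentity_of_readings` with: junk labels (`S` meets the block) ↦ ★ (s2) `orbFamGExt_slotPerm_eq_zero_of_tensor_of_split`; labels off the block ↦ the four readings
`hβ` ↦ ★ `orbFamGExt_div_archRG_slotPerm_eq_of_tensor` (`m_v = mcl_v(cl_v c)`, `g_v = chartOrbGLoc … f_v`, `Rβ` = its `¬p`-factor), `hα` ↦ ★ `alphaReading_of_classMul` (`r_v = F_v(cl_v c)`,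
`Rα` = ★ (s1)'s summand), `hIT` ↦ the hypothesis, `hgen` ↦ ★ `weightedCompactClause_letters` (E1's compact clause × the weight, `hmclF`).
TWO-FRAME HYGIENE (LH7-p01 (g8), ★ (T1)'s docblock): the `β`-frame measure facts are INSTANCE families (every ★ β-only slice is called as is), the `α`-frame measure facts of the
families `ν′_w`, `tα` are an `And`-PACKAGE (`hαm`, `hαt`) fed by term-mode `haveI` under the place binder (in `Rα`) and pointwise inside the proof (★ hα call); the single global measures
`ν′, νβ` are ordinary instances.  The quotient σ-algebras and the torus Haar families are PER LABEL (`tα tβ : ∀ S w, …`) and FREE, so that the pen's∕(T1)'s ties (`νβ_w|_I = ι⁎ν′_w`,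
`tβ = (ι|_T)⁎tα`) are instantiations, not constraints of this file.  §2 `ballIdentity_of_slices_of_and` = the same head with NO measure-class instance family
in scope at all (both frames as `And`-packages; LHref-N (g5) BOX LH2 #76's re-cut), the letter a two-frame consumer ((G1) `ArchEPAssemblyBallTransfer`) binds without the hazard.
HONEST LABEL: HC_CM is proved only modulo the 7 printed citations (2 remaining: hLiu418 = `stmt-HodgeConjecture-24832`, h413 = `stmt-HodgeConjecture-24833`) until rung 0 closes; count-neutral —
a docking of ★ files modulo `hIT`, pays nothing alone.

## References
* [Rogawski1990] J. D. Rogawski, *Automorphic Representations of Unitary Groups in Three Variables*, Ann. of Math. Stud. 123 (1990), §4.1 (4.1.1) p. 39 (`Φ^st`), §8.2 p. 122, §8.3 p. 124,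
  §14.2 (14.2.1) pp. 232–233 (the archimedean transfer identity being assembled).
* [Shelstad1979] D. Shelstad, *Characters and inner forms of a quasi-split group over ℝ*, Compositio Math. 39 (1979), §4 p. 22, Lemma 4.2 p. 23 (partner classes), Thm. 4.1 p. 21.
* [Bouaziz1994IntegralesOrbitales] A. Bouaziz, *Intégrales orbitales sur les groupes de Lie réductifs*, Ann. Sci. ÉNS (4) 27 (1994), §6.2 p. 591 (Euler–Poincaré functions as generators).
* [Folland1995] G. B. Folland, *A Course in Abstract Harmonic Analysis* (1995), §2.2; §2.6 Thm. 2.49, (2.52).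
-/

set_option autoImplicit false

noncomputable section

open MeasureTheory MeasureTheory.Measure NumberField NumberField.InfinitePlace Matrix Complex Topology
open Literature.MeasureTheory.Group Literature.NumberTheory.Rogawski1990 Literature.NumberTheory.Automorphic Literature.NumberTheory.Automorphic.UnitaryGroup
  Literature.NumberTheory.Automorphic.ArchCartan
open scoped MatrixGroups Matrix Classical ENNReal NNReal

namespace Literature.NumberTheory.Rogawski1990

section BallIdentity

variable (L : Type) [Field L] [NumberField L] [IsCMField L] (α β : Fin 3 → L)
  -- the `β`-frame (E3a: `β₀`): σ-algebras∕topology as instance families, per-LABEL quotient σ-algebras, measure facts as INSTANCE families (every ★ β-only slice is called as is)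
  [∀ w : {w : InfinitePlace L // IsComplex w}, MeasurableSpace ↥(archLocal L 3 (Matrix.diagonal β) w)]
  [∀ w : {w : InfinitePlace L // IsComplex w}, BorelSpace ↥(archLocal L 3 (Matrix.diagonal β) w)]
  [∀ w : {w : InfinitePlace L // IsComplex w}, LocallyCompactSpace ↥(archLocal L 3 (Matrix.diagonal β) w)]
  [∀ w : {w : InfinitePlace L // IsComplex w}, SecondCountableTopology ↥(archLocal L 3 (Matrix.diagonal β) w)]
  [MeasurableSpace ↥(arch (↥(maximalRealSubfield L)) L (IsCMField.complexConj L) 3 (Matrix.diagonal β))]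
  [BorelSpace ↥(arch (↥(maximalRealSubfield L)) L (IsCMField.complexConj L) 3 (Matrix.diagonal β))]
  [∀ (S : Finset {w : InfinitePlace L // IsComplex w}) (w : {w : InfinitePlace L // IsComplex w}), MeasurableSpace (↥(archLocal L 3 (Matrix.diagonal β) w) ⧸ chartTorusGLoc L β w S)]
  [∀ (S : Finset {w : InfinitePlace L // IsComplex w}) (w : {w : InfinitePlace L // IsComplex w}), BorelSpace (↥(archLocal L 3 (Matrix.diagonal β) w) ⧸ chartTorusGLoc L β w S)]
  (νβw : ∀ w : {w : InfinitePlace L // IsComplex w}, Measure ↥(archLocal L 3 (Matrix.diagonal β) w)) [∀ w, (νβw w).IsHaarMeasure] [∀ w, (νβw w).IsMulRightInvariant]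
  (νβ : Measure ↥(arch (↥(maximalRealSubfield L)) L (IsCMField.complexConj L) 3 (Matrix.diagonal β))) [νβ.IsHaarMeasure] [νβ.IsMulRightInvariant]
  (hνβ : νβ = (Measure.pi νβw).map (archPiEquivCM 3 L (Matrix.diagonal β)).symm)
  (tβ : ∀ (S : Finset {w : InfinitePlace L // IsComplex w}) (w : {w : InfinitePlace L // IsComplex w}), Measure ↥(chartTorusGLoc L β w S))
  [∀ S w, (tβ S w).IsHaarMeasure] [∀ S w, (tβ S w).IsInvInvariant]
  -- the `α`-frame: σ-algebras∕topology as instance families, per-LABEL quotient σ-algebras; measure facts of the FAMILIES `ν′w`, `tα` as `And`-PACKAGES (two-frame hygiene)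
  [∀ w : {w : InfinitePlace L // IsComplex w}, MeasurableSpace ↥(archLocal L 3 (Matrix.diagonal α) w)]
  [∀ w : {w : InfinitePlace L // IsComplex w}, BorelSpace ↥(archLocal L 3 (Matrix.diagonal α) w)]
  [∀ w : {w : InfinitePlace L // IsComplex w}, LocallyCompactSpace ↥(archLocal L 3 (Matrix.diagonal α) w)]
  [∀ w : {w : InfinitePlace L // IsComplex w}, SecondCountableTopology ↥(archLocal L 3 (Matrix.diagonal α) w)]
  [MeasurableSpace ↥(arch (↥(maximalRealSubfield L)) L (IsCMField.complexConj L) 3 (Matrix.diagonal α))]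
  [BorelSpace ↥(arch (↥(maximalRealSubfield L)) L (IsCMField.complexConj L) 3 (Matrix.diagonal α))]
  [∀ (S : Finset {w : InfinitePlace L // IsComplex w}) (w : {w : InfinitePlace L // IsComplex w}), MeasurableSpace (↥(archLocal L 3 (Matrix.diagonal α) w) ⧸ chartTorusGLoc L α w S)]
  [∀ (S : Finset {w : InfinitePlace L // IsComplex w}) (w : {w : InfinitePlace L // IsComplex w}), BorelSpace (↥(archLocal L 3 (Matrix.diagonal α) w) ⧸ chartTorusGLoc L α w S)]
  (ν'w : ∀ w : {w : InfinitePlace L // IsComplex w}, Measure ↥(archLocal L 3 (Matrix.diagonal α) w))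
  (hαm : ∀ w : {w : InfinitePlace L // IsComplex w}, (ν'w w).IsHaarMeasure ∧ (ν'w w).IsMulRightInvariant)
  (ν' : Measure ↥(arch (↥(maximalRealSubfield L)) L (IsCMField.complexConj L) 3 (Matrix.diagonal α))) [ν'.IsHaarMeasure] [ν'.IsMulRightInvariant]
  (hν : ν' = (Measure.pi ν'w).map (archPiEquivCM 3 L (Matrix.diagonal α)).symm)
  (tα : ∀ (S : Finset {w : InfinitePlace L // IsComplex w}) (w : {w : InfinitePlace L // IsComplex w}), Measure ↥(chartTorusGLoc L α w S))
  (hαt : ∀ (S : Finset {w : InfinitePlace L // IsComplex w}) (w : {w : InfinitePlace L // IsComplex w}), (tα S w).IsHaarMeasure ∧ (tα S w).IsInvInvariant)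
  -- the block: the `α`-DEFINITE places as a decidable predicate (★ E3-CORE∕(L1)'s frame; `Fintype` of the two index subtypes INFERRED, as (L1) does)
  (p : {w : InfinitePlace L // IsComplex w} → Prop) [DecidablePred p]

include hνβ hν hαm hαt in
/-- **THE PER-BALL IDENTITY FROM THE SLICES, modulo the block transport `hIT`** — HANDOFF-E3a §3 step (3).  Binders: the frames' guards (`hα hherm hβ0`, `hβsplit` = every place is
`β`-split — `β₀`: ★ `mem_splitChartPlaces_quasiSplitWeights`), `hp` (the block IS the set of `α`-definite places), `a′ ∈ C_c(G′_∞)`, the per-ball tensor `f ∈ C_c(G_∞)` of the ★ §2(7)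
shape `hf` (weights `mcl`, generators `fw`, coupling `G`), the ball data `b ε F h` with `hmclF` (`mcl = 2F∕h`), `hFε` (`F_v` lives in `ball b_v ε_v`), `hh0` (`h_v ≠ 0` there), the E1
SPLIT∕COMPACT clauses `hsplit`∕`hcpt` of each `fw v` (★ `exists_epGenerator_choice` fields verbatim), and `hIT` in ★ E3-CORE's letter (LHS = ★ hβ's `¬p`-factor, RHS = ★ hα's∕★ (s1)'s
summand).  Conclusion: `SS_β(f) S c = 3⁻¹ ^ Fintype.card {w // p w} * SS_α(a″) S c` on every `RegG S`, `a″ := (∏_v F_v ∘ cl_v) · a′` (★ hα's literal).  Proof: ★ (L1) `ballIdentity_of_readings`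
fed by ★ (s2) (junk labels) and ⟨★ hβ, ★ hα, `hIT`, ★ hgen⟩ (labels off the block).
[cite: Rogawski1990, §4.1 (4.1.1) p. 39; §14.2 (14.2.1) pp. 232–233] [cite: Shelstad1979, §4 p. 22; Lemma 4.2 p. 23] [cite: Bouaziz1994IntegralesOrbitales, §6.2 p. 591] [cite: Folland1995, §2.6 (2.52)] -/
theorem ballIdentity_of_slices (hα : ∀ i, α i ≠ 0) (hherm : ∀ i, (IsCMField.complexConj L (α i) : L) = α i) (hβ0 : ∀ i, β i ≠ 0)
    (hβsplit : ∀ w : {w : InfinitePlace L // IsComplex w}, w ∈ splitChartPlaces L β) (hp : ∀ w, p w ↔ w ∉ splitChartPlaces L α)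
    -- the `α`-side test function and the per-ball `β`-side tensor
    {a' : ↥(arch (↥(maximalRealSubfield L)) L (IsCMField.complexConj L) 3 (Matrix.diagonal α)) → ℂ} (ha'c : Continuous a') (ha's : HasCompactSupport a')
    {f : ↥(arch (↥(maximalRealSubfield L)) L (IsCMField.complexConj L) 3 (Matrix.diagonal β)) → ℂ} (hfc : Continuous f) (hfs : HasCompactSupport f)
    (mcl : {w : {w : InfinitePlace L // IsComplex w} // p w} → ℂ × ℂ × ℂ → ℂ) (hmclc : ∀ w, Continuous (mcl w))
    (fw : ∀ w : {w : {w : InfinitePlace L // IsComplex w} // p w}, ↥(archLocal L 3 (Matrix.diagonal β) w.1) → ℂ) (hfw : ∀ w, Measurable (fw w))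
    (G : ({w : {w : InfinitePlace L // IsComplex w} // p w} → ℂ × ℂ × ℂ) →
      (∀ w' : {w : {w : InfinitePlace L // IsComplex w} // ¬ p w}, ↥(archLocal L 3 (Matrix.diagonal β) w'.1)) → ℂ)
    (hf : ∀ k, f k = (∏ w : {w : {w : InfinitePlace L // IsComplex w} // p w}, mcl w (bzClassG L β k w.1) * fw w (archPiEquivCM 3 L (Matrix.diagonal β) k w.1)) *
      G (fun w => bzClassG L β k w.1) (fun w' => archPiEquivCM 3 L (Matrix.diagonal β) k w'.1))
    -- the ball data at each definite place: centre, radius, partition factor, generator's `h`; their clauses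
    (b : {w : {w : InfinitePlace L // IsComplex w} // p w} → ℂ × ℂ × ℂ) (ε : {w : {w : InfinitePlace L // IsComplex w} // p w} → ℝ)
    (F : {w : {w : InfinitePlace L // IsComplex w} // p w} → ℂ × ℂ × ℂ → ℝ) (h : {w : {w : InfinitePlace L // IsComplex w} // p w} → ℂ × ℂ × ℂ → ℂ)
    (hmclF : ∀ w z, mcl w z = 2 * ((F w z : ℝ) : ℂ) / h w z)
    (hFε : ∀ w z, F w z ≠ 0 → dist z (b w) < ε w)
    (hh0 : ∀ w z, dist z (b w) < ε w → h w z ≠ 0)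
    (hsplit : ∀ (w : {w : {w : InfinitePlace L // IsComplex w} // p w}) (S' : Finset {w : InfinitePlace L // IsComplex w})
      (c' : {w : InfinitePlace L // IsComplex w} → Fin 3 → ℝ),
      w.1 ∈ S' → c' w.1 0 ≠ 0 → dist (bzClassMapG S' c' w.1) (b w) < ε w → chartOrbGLoc L β w.1 S' (νβw w.1) (fw w) (c' w.1) = 0)
    (hcpt : ∀ (w : {w : {w : InfinitePlace L // IsComplex w} // p w}) (S' : Finset {w : InfinitePlace L // IsComplex w})
      (c' : {w : InfinitePlace L // IsComplex w} → Fin 3 → ℝ),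
      w.1 ∉ S' → (Function.Injective fun i : Fin 3 => Circle.exp (c' w.1 i)) → dist (bzClassMapG S' c' w.1) (b w) < ε w →
        ∑ σ : Equiv.Perm (Fin 3), chartOrbGLoc L β w.1 S' (νβw w.1) (fw w) (c' w.1 ∘ σ) = h w (bzClassMapG S' c' w.1))
    -- the block transport, ★ E3-CORE's letter (LHS: ★ hβ's `¬p`-block reading of the coupling; RHS: ★ hα's = ★ (s1)'s summand), quantified over the labels OFF the block
    (hIT : ∀ (S : Finset {w : InfinitePlace L // IsComplex w}) (c : {w : InfinitePlace L // IsComplex w} → Fin 3 → ℝ), c ∈ RegG S → (∀ w, p w → w ∉ S) →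
      (∏ w : {w : {w : InfinitePlace L // IsComplex w} // p w}, ((F w (bzClassMapG S c w.1) : ℝ) : ℂ)) ≠ 0 →
      ∀ ρ₂ ∈ partnerPerms (S.subtype fun w => ¬ p w),
        (∏ w' : {w : {w : InfinitePlace L // IsComplex w} // ¬ p w}, ((tβ S w'.1 (chartBoxImgGLoc L β w'.1 S)).toReal : ℂ)) *
            ∫ b' : (∀ w' : {w : {w : InfinitePlace L // IsComplex w} // ¬ p w}, ↥(archLocal L 3 (Matrix.diagonal β) w'.1) ⧸ chartTorusGLoc L β w'.1 S),
              G (fun w => bzClassMapG S c w.1)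
                (fun w' => descConj (gprimeBlockAt L β w'.1 S (fun i => c w'.1 (ρ₂ w' i))) (chartTorusGLoc L β w'.1 S)
                  (forall_mem_chartTorusGLoc_comm L β w'.1 S (fun i => c w'.1 (ρ₂ w' i))) id (b' w'))
              ∂(Measure.pi fun w' : {w : {w : InfinitePlace L // IsComplex w} // ¬ p w} =>
                  quotientMeasure (chartTorusGLoc L β w'.1 S) (tβ S w'.1) (isClosed_chartTorusGLoc L β w'.1 S) (νβw w'.1)) =
          (∏ w' : {w : {w : InfinitePlace L // IsComplex w} // ¬ p w}, ((tα S w'.1 (chartBoxImgGLoc L α w'.1 S)).toReal : ℂ)) *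
            ∫ b : (∀ w' : {w : {w : InfinitePlace L // IsComplex w} // ¬ p w}, ↥(archLocal L 3 (Matrix.diagonal α) w'.1) ⧸ chartTorusGLoc L α w'.1 S),
              (∫ g : (∀ w : {w : {w : InfinitePlace L // IsComplex w} // p w}, ↥(archLocal L 3 (Matrix.diagonal α) w.1)),
                a' ((archPiEquivCM 3 L (Matrix.diagonal α)).symm
                  ((MeasurableEquiv.piEquivPiSubtypeProd (fun w : {w : InfinitePlace L // IsComplex w} => ↥(archLocal L 3 (Matrix.diagonal α) w)) p).symm
                    (fun w => g w * gprimeBlockAt L α w.1 S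
                        (slotPerm ((Equiv.piEquivPiSubtypeProd p (fun _ : {w : InfinitePlace L // IsComplex w} => Equiv.Perm (Fin 3))).symm (1, ρ₂)) c w.1) * (g w)⁻¹,
                      fun w' => descConj (gprimeBlockAt L α w'.1 S
                          (slotPerm ((Equiv.piEquivPiSubtypeProd p (fun _ : {w : InfinitePlace L // IsComplex w} => Equiv.Perm (Fin 3))).symm (1, ρ₂)) c w'.1))
                        (chartTorusGLoc L α w'.1 S)
                        (forall_mem_chartTorusGLoc_comm L α w'.1 S
                          (slotPerm ((Equiv.piEquivPiSubtypeProd p (fun _ : {w : InfinitePlace L // IsComplex w} => Equiv.Perm (Fin 3))).symm (1, ρ₂)) c w'.1))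
                        id (b w'))))
                ∂(Measure.pi fun w : {w : {w : InfinitePlace L // IsComplex w} // p w} => ν'w w.1))
              ∂(Measure.pi fun w' : {w : {w : InfinitePlace L // IsComplex w} // ¬ p w} =>
                  haveI := (hαt S w'.1).1; haveI := (hαt S w'.1).2; haveI := (hαm w'.1).1; haveI := (hαm w'.1).2
                  quotientMeasure (chartTorusGLoc L α w'.1 S) (tα S w'.1) (isClosed_chartTorusGLoc L α w'.1 S) (ν'w w'.1))) :
    ∀ (S : Finset {w : InfinitePlace L // IsComplex w}) (c : {w : InfinitePlace L // IsComplex w} → Fin 3 → ℝ), c ∈ RegG S →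
      stableSumG (orbFamGExt L β νβ f) S c =
        ((3 : ℂ)⁻¹) ^ Fintype.card {w : {w : InfinitePlace L // IsComplex w} // p w} *
          stableSumG (orbFamGExt L α ν' (fun k => ((∏ v : {w : {w : InfinitePlace L // IsComplex w} // p w}, F v (bzClassG L α k v.1) : ℝ) : ℂ) * a' k)) S c := by
  have hpα : ∀ w, p w → w ∉ splitChartPlaces L α := fun w hw => (hp w).1 hw
  have hSβ : ∀ (S : Finset {w : InfinitePlace L // IsComplex w}) (w), w ∈ S → w ∈ splitChartPlaces L β := fun _ w _ => hβsplit w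
  -- the weight lives in the ball (from `hmclF` + `hFε`)
  have hmclε : ∀ (w : {w : {w : InfinitePlace L // IsComplex w} // p w}) (z : ℂ × ℂ × ℂ), mcl w z ≠ 0 → dist z (b w) < ε w := by
    intro w z hz
    refine hFε w z fun hF0 => hz ?_
    rw [hmclF, hF0, Complex.ofReal_zero, mul_zero, zero_div]
  refine ballIdentity_of_readings L α β ν' νβ p hp f _ (fun S c hc hjk ρ hρ => ?_) (fun S c hc hS => ?_)
  · -- junk labels: ★ (s2) at the witness place
    obtain ⟨w₀, hw₀S, hpw₀⟩ := hjk
    exact orbFamGExt_slotPerm_eq_zero_of_tensor_of_split L β S νβw νβ hνβ (tβ S) p hβ0 (hSβ S) hc hfc hfs mcl fw G hf ⟨w₀, hpw₀⟩ hw₀S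
      (b ⟨w₀, hpw₀⟩) (ε ⟨w₀, hpw₀⟩) (hmclε ⟨w₀, hpw₀⟩) (fun c' h1 h2 h3 => hsplit ⟨w₀, hpw₀⟩ S c' h1 h2 h3) hρ
  · -- labels off the block: the four readings
    have hSα : ∀ w, w ∈ S → w ∈ splitChartPlaces L α := fun w hw => by
      by_contra hws
      exact hS w ((hp w).2 hws) hw
    have hreg := (ArchCartan.mem_regG_iff S c).1 hc
    refine ⟨fun w => mcl w (bzClassMapG S c w.1), fun w cw => chartOrbGLoc L β w.1 S (νβw w.1) (fw w) cw,
      fun w => ((F w (bzClassMapG S c w.1) : ℝ) : ℂ),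
      -- `Rβ ρ₂`: ★ hβ's `¬p`-block reading of the coupling at the relabelled `¬p`-coordinates
      fun ρ₂ => (∏ w' : {w : {w : InfinitePlace L // IsComplex w} // ¬ p w}, ((tβ S w'.1 (chartBoxImgGLoc L β w'.1 S)).toReal : ℂ)) *
        ∫ b' : (∀ w' : {w : {w : InfinitePlace L // IsComplex w} // ¬ p w}, ↥(archLocal L 3 (Matrix.diagonal β) w'.1) ⧸ chartTorusGLoc L β w'.1 S),
          G (fun w => bzClassMapG S c w.1)
            (fun w' => descConj (gprimeBlockAt L β w'.1 S (fun i => c w'.1 (ρ₂ w' i))) (chartTorusGLoc L β w'.1 S)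
              (forall_mem_chartTorusGLoc_comm L β w'.1 S (fun i => c w'.1 (ρ₂ w' i))) id (b' w'))
          ∂(Measure.pi fun w' : {w : {w : InfinitePlace L // IsComplex w} // ¬ p w} =>
              quotientMeasure (chartTorusGLoc L β w'.1 S) (tβ S w'.1) (isClosed_chartTorusGLoc L β w'.1 S) (νβw w'.1)),
      -- `Rα ρ₂`: ★ hα's = ★ (s1)'s summand
      fun ρ₂ => (∏ w' : {w : {w : InfinitePlace L // IsComplex w} // ¬ p w}, ((tα S w'.1 (chartBoxImgGLoc L α w'.1 S)).toReal : ℂ)) *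
        ∫ b : (∀ w' : {w : {w : InfinitePlace L // IsComplex w} // ¬ p w}, ↥(archLocal L 3 (Matrix.diagonal α) w'.1) ⧸ chartTorusGLoc L α w'.1 S),
          (∫ g : (∀ w : {w : {w : InfinitePlace L // IsComplex w} // p w}, ↥(archLocal L 3 (Matrix.diagonal α) w.1)),
            a' ((archPiEquivCM 3 L (Matrix.diagonal α)).symm
              ((MeasurableEquiv.piEquivPiSubtypeProd (fun w : {w : InfinitePlace L // IsComplex w} => ↥(archLocal L 3 (Matrix.diagonal α) w)) p).symm
                (fun w => g w * gprimeBlockAt L α w.1 S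
                    (slotPerm ((Equiv.piEquivPiSubtypeProd p (fun _ : {w : InfinitePlace L // IsComplex w} => Equiv.Perm (Fin 3))).symm (1, ρ₂)) c w.1) * (g w)⁻¹,
                  fun w' => descConj (gprimeBlockAt L α w'.1 S
                      (slotPerm ((Equiv.piEquivPiSubtypeProd p (fun _ : {w : InfinitePlace L // IsComplex w} => Equiv.Perm (Fin 3))).symm (1, ρ₂)) c w'.1))
                    (chartTorusGLoc L α w'.1 S)
                    (forall_mem_chartTorusGLoc_comm L α w'.1 S
                      (slotPerm ((Equiv.piEquivPiSubtypeProd p (fun _ : {w : InfinitePlace L // IsComplex w} => Equiv.Perm (Fin 3))).symm (1, ρ₂)) c w'.1))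
                    id (b w'))))
            ∂(Measure.pi fun w : {w : {w : InfinitePlace L // IsComplex w} // p w} => ν'w w.1))
          ∂(Measure.pi fun w' : {w : {w : InfinitePlace L // IsComplex w} // ¬ p w} =>
              haveI := (hαt S w'.1).1; haveI := (hαt S w'.1).2; haveI := (hαm w'.1).1; haveI := (hαm w'.1).2
              quotientMeasure (chartTorusGLoc L α w'.1 S) (tα S w'.1) (isClosed_chartTorusGLoc L α w'.1 S) (ν'w w'.1)),
      ?_, ?_, ?_, ?_⟩
    · -- hβ: ★ `orbFamGExt_div_archRG_slotPerm_eq_of_tensor` (β-only file, called as is)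
      exact orbFamGExt_div_archRG_slotPerm_eq_of_tensor L β S νβw p νβ hνβ (tβ S) hβ0 (hSβ S) hS hc hfc hfs mcl hmclc fw hfw G hf
    · -- hα: ★ `alphaReading_of_classMul` (α-only file; the `α`-frame measure facts enter here, pointwise, from the packages)
      haveI : ∀ w : {w : InfinitePlace L // IsComplex w}, (ν'w w).IsHaarMeasure := fun w => (hαm w).1
      haveI : ∀ w : {w : InfinitePlace L // IsComplex w}, (ν'w w).IsMulRightInvariant := fun w => (hαm w).2
      haveI : ∀ w : {w : InfinitePlace L // IsComplex w}, (tα S w).IsHaarMeasure := fun w => (hαt S w).1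
      haveI : ∀ w : {w : InfinitePlace L // IsComplex w}, (tα S w).IsInvInvariant := fun w => (hαt S w).2
      exact alphaReading_of_classMul L α S ν'w ν' hν (tα S) p hα hherm hSα hpα hc ha'c ha's F
    · -- hIT: the hypothesis
      exact hIT S c hc hS
    · -- hgen: ★ `weightedCompactClause_letters` at each definite place (compact chart there: `w ∉ S`, regular angles)
      intro w
      exact weightedCompactClause_letters L β w.1 (νβw w.1) (hh0 w) (fun S' c' h1 h2 h3 => hcpt w S' c' h1 h2 h3)
        (F := fun z => ((F w z : ℝ) : ℂ)) (fun z hz => hFε w z fun h0 => hz (by rw [h0, Complex.ofReal_zero])) (hS w.1 w.2) (hreg.1 w.1 (hS w.1 w.2))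
        (hmclF w _) rfl (fun _ => rfl)


include hνβ hν hαm hαt in
/-- **ED. 2 (append-only): the per-ball identity with the class multipliers only MEASURABLE** (`hmclc : ∀ w, Measurable (mcl w)`; otherwise `ballIdentity_of_slices` VERBATIM, proof
identical with ★ hβ ED. 2 `orbFamGExt_div_archRG_slotPerm_eq_of_tensor_of_measurable`).  Needed by the (BI)-dock `ballIdentity_of_coupling`: its consumer ★ (G1) p852328 binds the inline
weight `2F∕h` with the factor supported in the OPEN generator ball only, where `2F∕h` is measurable but need not be continuous.
[cite: Rogawski1990, §4.1 (4.1.1) p. 39; §14.2 (14.2.1) pp. 232–233] [cite: Shelstad1979, §4 p. 22; Lemma 4.2 p. 23] [cite: Bouaziz1994IntegralesOrbitales, §6.2 p. 591] [cite: Folland1995, §2.6 (2.52)] -/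
theorem ballIdentity_of_slices_of_measurable (hα : ∀ i, α i ≠ 0) (hherm : ∀ i, (IsCMField.complexConj L (α i) : L) = α i) (hβ0 : ∀ i, β i ≠ 0)
    (hβsplit : ∀ w : {w : InfinitePlace L // IsComplex w}, w ∈ splitChartPlaces L β) (hp : ∀ w, p w ↔ w ∉ splitChartPlaces L α)
    -- the `α`-side test function and the per-ball `β`-side tensor
    {a' : ↥(arch (↥(maximalRealSubfield L)) L (IsCMField.complexConj L) 3 (Matrix.diagonal α)) → ℂ} (ha'c : Continuous a') (ha's : HasCompactSupport a')
    {f : ↥(arch (↥(maximalRealSubfield L)) L (IsCMField.complexConj L) 3 (Matrix.diagonal β)) → ℂ} (hfc : Continuous f) (hfs : HasCompactSupport f)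
    (mcl : {w : {w : InfinitePlace L // IsComplex w} // p w} → ℂ × ℂ × ℂ → ℂ) (hmclc : ∀ w, Measurable (mcl w))
    (fw : ∀ w : {w : {w : InfinitePlace L // IsComplex w} // p w}, ↥(archLocal L 3 (Matrix.diagonal β) w.1) → ℂ) (hfw : ∀ w, Measurable (fw w))
    (G : ({w : {w : InfinitePlace L // IsComplex w} // p w} → ℂ × ℂ × ℂ) →
      (∀ w' : {w : {w : InfinitePlace L // IsComplex w} // ¬ p w}, ↥(archLocal L 3 (Matrix.diagonal β) w'.1)) → ℂ)
    (hf : ∀ k, f k = (∏ w : {w : {w : InfinitePlace L // IsComplex w} // p w}, mcl w (bzClassG L β k w.1) * fw w (archPiEquivCM 3 L (Matrix.diagonal β) k w.1)) *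
      G (fun w => bzClassG L β k w.1) (fun w' => archPiEquivCM 3 L (Matrix.diagonal β) k w'.1))
    -- the ball data at each definite place: centre, radius, partition factor, generator's `h`; their clauses
    (b : {w : {w : InfinitePlace L // IsComplex w} // p w} → ℂ × ℂ × ℂ) (ε : {w : {w : InfinitePlace L // IsComplex w} // p w} → ℝ)
    (F : {w : {w : InfinitePlace L // IsComplex w} // p w} → ℂ × ℂ × ℂ → ℝ) (h : {w : {w : InfinitePlace L // IsComplex w} // p w} → ℂ × ℂ × ℂ → ℂ)
    (hmclF : ∀ w z, mcl w z = 2 * ((F w z : ℝ) : ℂ) / h w z)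
    (hFε : ∀ w z, F w z ≠ 0 → dist z (b w) < ε w)
    (hh0 : ∀ w z, dist z (b w) < ε w → h w z ≠ 0)
    (hsplit : ∀ (w : {w : {w : InfinitePlace L // IsComplex w} // p w}) (S' : Finset {w : InfinitePlace L // IsComplex w})
      (c' : {w : InfinitePlace L // IsComplex w} → Fin 3 → ℝ),
      w.1 ∈ S' → c' w.1 0 ≠ 0 → dist (bzClassMapG S' c' w.1) (b w) < ε w → chartOrbGLoc L β w.1 S' (νβw w.1) (fw w) (c' w.1) = 0)
    (hcpt : ∀ (w : {w : {w : InfinitePlace L // IsComplex w} // p w}) (S' : Finset {w : InfinitePlace L // IsComplex w})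
      (c' : {w : InfinitePlace L // IsComplex w} → Fin 3 → ℝ),
      w.1 ∉ S' → (Function.Injective fun i : Fin 3 => Circle.exp (c' w.1 i)) → dist (bzClassMapG S' c' w.1) (b w) < ε w →
        ∑ σ : Equiv.Perm (Fin 3), chartOrbGLoc L β w.1 S' (νβw w.1) (fw w) (c' w.1 ∘ σ) = h w (bzClassMapG S' c' w.1))
    -- the block transport, ★ E3-CORE's letter (LHS: ★ hβ's `¬p`-block reading of the coupling; RHS: ★ hα's = ★ (s1)'s summand), quantified over the labels OFF the block
    (hIT : ∀ (S : Finset {w : InfinitePlace L // IsComplex w}) (c : {w : InfinitePlace L // IsComplex w} → Fin 3 → ℝ), c ∈ RegG S → (∀ w, p w → w ∉ S) →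
      (∏ w : {w : {w : InfinitePlace L // IsComplex w} // p w}, ((F w (bzClassMapG S c w.1) : ℝ) : ℂ)) ≠ 0 →
      ∀ ρ₂ ∈ partnerPerms (S.subtype fun w => ¬ p w),
        (∏ w' : {w : {w : InfinitePlace L // IsComplex w} // ¬ p w}, ((tβ S w'.1 (chartBoxImgGLoc L β w'.1 S)).toReal : ℂ)) *
            ∫ b' : (∀ w' : {w : {w : InfinitePlace L // IsComplex w} // ¬ p w}, ↥(archLocal L 3 (Matrix.diagonal β) w'.1) ⧸ chartTorusGLoc L β w'.1 S),
              G (fun w => bzClassMapG S c w.1)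
                (fun w' => descConj (gprimeBlockAt L β w'.1 S (fun i => c w'.1 (ρ₂ w' i))) (chartTorusGLoc L β w'.1 S)
                  (forall_mem_chartTorusGLoc_comm L β w'.1 S (fun i => c w'.1 (ρ₂ w' i))) id (b' w'))
              ∂(Measure.pi fun w' : {w : {w : InfinitePlace L // IsComplex w} // ¬ p w} =>
                  quotientMeasure (chartTorusGLoc L β w'.1 S) (tβ S w'.1) (isClosed_chartTorusGLoc L β w'.1 S) (νβw w'.1)) =
          (∏ w' : {w : {w : InfinitePlace L // IsComplex w} // ¬ p w}, ((tα S w'.1 (chartBoxImgGLoc L α w'.1 S)).toReal : ℂ)) *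
            ∫ b : (∀ w' : {w : {w : InfinitePlace L // IsComplex w} // ¬ p w}, ↥(archLocal L 3 (Matrix.diagonal α) w'.1) ⧸ chartTorusGLoc L α w'.1 S),
              (∫ g : (∀ w : {w : {w : InfinitePlace L // IsComplex w} // p w}, ↥(archLocal L 3 (Matrix.diagonal α) w.1)),
                a' ((archPiEquivCM 3 L (Matrix.diagonal α)).symm
                  ((MeasurableEquiv.piEquivPiSubtypeProd (fun w : {w : InfinitePlace L // IsComplex w} => ↥(archLocal L 3 (Matrix.diagonal α) w)) p).symm
                    (fun w => g w * gprimeBlockAt L α w.1 S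
                        (slotPerm ((Equiv.piEquivPiSubtypeProd p (fun _ : {w : InfinitePlace L // IsComplex w} => Equiv.Perm (Fin 3))).symm (1, ρ₂)) c w.1) * (g w)⁻¹,
                      fun w' => descConj (gprimeBlockAt L α w'.1 S
                          (slotPerm ((Equiv.piEquivPiSubtypeProd p (fun _ : {w : InfinitePlace L // IsComplex w} => Equiv.Perm (Fin 3))).symm (1, ρ₂)) c w'.1))
                        (chartTorusGLoc L α w'.1 S)
                        (forall_mem_chartTorusGLoc_comm L α w'.1 S
                          (slotPerm ((Equiv.piEquivPiSubtypeProd p (fun _ : {w : InfinitePlace L // IsComplex w} => Equiv.Perm (Fin 3))).symm (1, ρ₂)) c w'.1))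
                        id (b w'))))
                ∂(Measure.pi fun w : {w : {w : InfinitePlace L // IsComplex w} // p w} => ν'w w.1))
              ∂(Measure.pi fun w' : {w : {w : InfinitePlace L // IsComplex w} // ¬ p w} =>
                  haveI := (hαt S w'.1).1; haveI := (hαt S w'.1).2; haveI := (hαm w'.1).1; haveI := (hαm w'.1).2
                  quotientMeasure (chartTorusGLoc L α w'.1 S) (tα S w'.1) (isClosed_chartTorusGLoc L α w'.1 S) (ν'w w'.1))) :
    ∀ (S : Finset {w : InfinitePlace L // IsComplex w}) (c : {w : InfinitePlace L // IsComplex w} → Fin 3 → ℝ), c ∈ RegG S →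
      stableSumG (orbFamGExt L β νβ f) S c =
        ((3 : ℂ)⁻¹) ^ Fintype.card {w : {w : InfinitePlace L // IsComplex w} // p w} *
          stableSumG (orbFamGExt L α ν' (fun k => ((∏ v : {w : {w : InfinitePlace L // IsComplex w} // p w}, F v (bzClassG L α k v.1) : ℝ) : ℂ) * a' k)) S c := by
  have hpα : ∀ w, p w → w ∉ splitChartPlaces L α := fun w hw => (hp w).1 hw
  have hSβ : ∀ (S : Finset {w : InfinitePlace L // IsComplex w}) (w), w ∈ S → w ∈ splitChartPlaces L β := fun _ w _ => hβsplit w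
  -- the weight lives in the ball (from `hmclF` + `hFε`)
  have hmclε : ∀ (w : {w : {w : InfinitePlace L // IsComplex w} // p w}) (z : ℂ × ℂ × ℂ), mcl w z ≠ 0 → dist z (b w) < ε w := by
    intro w z hz
    refine hFε w z fun hF0 => hz ?_
    rw [hmclF, hF0, Complex.ofReal_zero, mul_zero, zero_div]
  refine ballIdentity_of_readings L α β ν' νβ p hp f _ (fun S c hc hjk ρ hρ => ?_) (fun S c hc hS => ?_)
  · -- junk labels: ★ (s2) at the witness place
    obtain ⟨w₀, hw₀S, hpw₀⟩ := hjk
    exact orbFamGExt_slotPerm_eq_zero_of_tensor_of_split L β S νβw νβ hνβ (tβ S) p hβ0 (hSβ S) hc hfc hfs mcl fw G hf ⟨w₀, hpw₀⟩ hw₀S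
      (b ⟨w₀, hpw₀⟩) (ε ⟨w₀, hpw₀⟩) (hmclε ⟨w₀, hpw₀⟩) (fun c' h1 h2 h3 => hsplit ⟨w₀, hpw₀⟩ S c' h1 h2 h3) hρ
  · -- labels off the block: the four readings
    have hSα : ∀ w, w ∈ S → w ∈ splitChartPlaces L α := fun w hw => by
      by_contra hws
      exact hS w ((hp w).2 hws) hw
    have hreg := (ArchCartan.mem_regG_iff S c).1 hc
    refine ⟨fun w => mcl w (bzClassMapG S c w.1), fun w cw => chartOrbGLoc L β w.1 S (νβw w.1) (fw w) cw,
      fun w => ((F w (bzClassMapG S c w.1) : ℝ) : ℂ),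
      -- `Rβ ρ₂`: ★ hβ's `¬p`-block reading of the coupling at the relabelled `¬p`-coordinates
      fun ρ₂ => (∏ w' : {w : {w : InfinitePlace L // IsComplex w} // ¬ p w}, ((tβ S w'.1 (chartBoxImgGLoc L β w'.1 S)).toReal : ℂ)) *
        ∫ b' : (∀ w' : {w : {w : InfinitePlace L // IsComplex w} // ¬ p w}, ↥(archLocal L 3 (Matrix.diagonal β) w'.1) ⧸ chartTorusGLoc L β w'.1 S),
          G (fun w => bzClassMapG S c w.1)
            (fun w' => descConj (gprimeBlockAt L β w'.1 S (fun i => c w'.1 (ρ₂ w' i))) (chartTorusGLoc L β w'.1 S)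
              (forall_mem_chartTorusGLoc_comm L β w'.1 S (fun i => c w'.1 (ρ₂ w' i))) id (b' w'))
          ∂(Measure.pi fun w' : {w : {w : InfinitePlace L // IsComplex w} // ¬ p w} =>
              quotientMeasure (chartTorusGLoc L β w'.1 S) (tβ S w'.1) (isClosed_chartTorusGLoc L β w'.1 S) (νβw w'.1)),
      -- `Rα ρ₂`: ★ hα's = ★ (s1)'s summand
      fun ρ₂ => (∏ w' : {w : {w : InfinitePlace L // IsComplex w} // ¬ p w}, ((tα S w'.1 (chartBoxImgGLoc L α w'.1 S)).toReal : ℂ)) *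
        ∫ b : (∀ w' : {w : {w : InfinitePlace L // IsComplex w} // ¬ p w}, ↥(archLocal L 3 (Matrix.diagonal α) w'.1) ⧸ chartTorusGLoc L α w'.1 S),
          (∫ g : (∀ w : {w : {w : InfinitePlace L // IsComplex w} // p w}, ↥(archLocal L 3 (Matrix.diagonal α) w.1)),
            a' ((archPiEquivCM 3 L (Matrix.diagonal α)).symm
              ((MeasurableEquiv.piEquivPiSubtypeProd (fun w : {w : InfinitePlace L // IsComplex w} => ↥(archLocal L 3 (Matrix.diagonal α) w)) p).symm
                (fun w => g w * gprimeBlockAt L α w.1 S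
                    (slotPerm ((Equiv.piEquivPiSubtypeProd p (fun _ : {w : InfinitePlace L // IsComplex w} => Equiv.Perm (Fin 3))).symm (1, ρ₂)) c w.1) * (g w)⁻¹,
                  fun w' => descConj (gprimeBlockAt L α w'.1 S
                      (slotPerm ((Equiv.piEquivPiSubtypeProd p (fun _ : {w : InfinitePlace L // IsComplex w} => Equiv.Perm (Fin 3))).symm (1, ρ₂)) c w'.1))
                    (chartTorusGLoc L α w'.1 S)
                    (forall_mem_chartTorusGLoc_comm L α w'.1 S
                      (slotPerm ((Equiv.piEquivPiSubtypeProd p (fun _ : {w : InfinitePlace L // IsComplex w} => Equiv.Perm (Fin 3))).symm (1, ρ₂)) c w'.1))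
                    id (b w'))))
            ∂(Measure.pi fun w : {w : {w : InfinitePlace L // IsComplex w} // p w} => ν'w w.1))
          ∂(Measure.pi fun w' : {w : {w : InfinitePlace L // IsComplex w} // ¬ p w} =>
              haveI := (hαt S w'.1).1; haveI := (hαt S w'.1).2; haveI := (hαm w'.1).1; haveI := (hαm w'.1).2
              quotientMeasure (chartTorusGLoc L α w'.1 S) (tα S w'.1) (isClosed_chartTorusGLoc L α w'.1 S) (ν'w w'.1)),
      ?_, ?_, ?_, ?_⟩
    · -- hβ: ★ ED. 2 `orbFamGExt_div_archRG_slotPerm_eq_of_tensor_of_measurable` (β-only file, called as is)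
      exact orbFamGExt_div_archRG_slotPerm_eq_of_tensor_of_measurable L β S νβw p νβ hνβ (tβ S) hβ0 (hSβ S) hS hc hfc hfs mcl hmclc fw hfw G hf
    · -- hα: ★ `alphaReading_of_classMul` (α-only file; the `α`-frame measure facts enter here, pointwise, from the packages)
      haveI : ∀ w : {w : InfinitePlace L // IsComplex w}, (ν'w w).IsHaarMeasure := fun w => (hαm w).1
      haveI : ∀ w : {w : InfinitePlace L // IsComplex w}, (ν'w w).IsMulRightInvariant := fun w => (hαm w).2
      haveI : ∀ w : {w : InfinitePlace L // IsComplex w}, (tα S w).IsHaarMeasure := fun w => (hαt S w).1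
      haveI : ∀ w : {w : InfinitePlace L // IsComplex w}, (tα S w).IsInvInvariant := fun w => (hαt S w).2
      exact alphaReading_of_classMul L α S ν'w ν' hν (tα S) p hα hherm hSα hpα hc ha'c ha's F
    · -- hIT: the hypothesis
      exact hIT S c hc hS
    · -- hgen: ★ `weightedCompactClause_letters` at each definite place (compact chart there: `w ∉ S`, regular angles)
      intro w
      exact weightedCompactClause_letters L β w.1 (νβw w.1) (hh0 w) (fun S' c' h1 h2 h3 => hcpt w S' c' h1 h2 h3)
        (F := fun z => ((F w z : ℝ) : ℂ)) (fun z hz => hFε w z fun h0 => hz (by rw [h0, Complex.ofReal_zero])) (hS w.1 w.2) (hreg.1 w.1 (hS w.1 w.2))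
        (hmclF w _) rfl (fun _ => rfl)

end BallIdentity

/-! ## §2 The same head with NO measure-class instance family in scope (both frames as `And`-packages) — the form a two-frame consumer ((G1)) binds -/

section BallIdentityAnd

variable (L : Type) [Field L] [NumberField L] [IsCMField L] (α β : Fin 3 → L)
  [∀ w : {w : InfinitePlace L // IsComplex w}, MeasurableSpace ↥(archLocal L 3 (Matrix.diagonal β) w)]
  [∀ w : {w : InfinitePlace L // IsComplex w}, BorelSpace ↥(archLocal L 3 (Matrix.diagonal β) w)]
  [∀ w : {w : InfinitePlace L // IsComplex w}, LocallyCompactSpace ↥(archLocal L 3 (Matrix.diagonal β) w)]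
  [∀ w : {w : InfinitePlace L // IsComplex w}, SecondCountableTopology ↥(archLocal L 3 (Matrix.diagonal β) w)]
  [MeasurableSpace ↥(arch (↥(maximalRealSubfield L)) L (IsCMField.complexConj L) 3 (Matrix.diagonal β))]
  [BorelSpace ↥(arch (↥(maximalRealSubfield L)) L (IsCMField.complexConj L) 3 (Matrix.diagonal β))]
  [∀ (S : Finset {w : InfinitePlace L // IsComplex w}) (w : {w : InfinitePlace L // IsComplex w}), MeasurableSpace (↥(archLocal L 3 (Matrix.diagonal β) w) ⧸ chartTorusGLoc L β w S)]
  [∀ (S : Finset {w : InfinitePlace L // IsComplex w}) (w : {w : InfinitePlace L // IsComplex w}), BorelSpace (↥(archLocal L 3 (Matrix.diagonal β) w) ⧸ chartTorusGLoc L β w S)]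
  (νβw : ∀ w : {w : InfinitePlace L // IsComplex w}, Measure ↥(archLocal L 3 (Matrix.diagonal β) w))
  (hνβm : ∀ w : {w : InfinitePlace L // IsComplex w}, (νβw w).IsHaarMeasure ∧ (νβw w).IsMulRightInvariant)
  (νβ : Measure ↥(arch (↥(maximalRealSubfield L)) L (IsCMField.complexConj L) 3 (Matrix.diagonal β))) [νβ.IsHaarMeasure] [νβ.IsMulRightInvariant]
  (hνβ : νβ = (Measure.pi νβw).map (archPiEquivCM 3 L (Matrix.diagonal β)).symm)
  (tβ : ∀ (S : Finset {w : InfinitePlace L // IsComplex w}) (w : {w : InfinitePlace L // IsComplex w}), Measure ↥(chartTorusGLoc L β w S))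
  (htβm : ∀ (S : Finset {w : InfinitePlace L // IsComplex w}) (w : {w : InfinitePlace L // IsComplex w}), (tβ S w).IsHaarMeasure ∧ (tβ S w).IsInvInvariant)
  [∀ w : {w : InfinitePlace L // IsComplex w}, MeasurableSpace ↥(archLocal L 3 (Matrix.diagonal α) w)]
  [∀ w : {w : InfinitePlace L // IsComplex w}, BorelSpace ↥(archLocal L 3 (Matrix.diagonal α) w)]
  [∀ w : {w : InfinitePlace L // IsComplex w}, LocallyCompactSpace ↥(archLocal L 3 (Matrix.diagonal α) w)]
  [∀ w : {w : InfinitePlace L // IsComplex w}, SecondCountableTopology ↥(archLocal L 3 (Matrix.diagonal α) w)]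
  [MeasurableSpace ↥(arch (↥(maximalRealSubfield L)) L (IsCMField.complexConj L) 3 (Matrix.diagonal α))]
  [BorelSpace ↥(arch (↥(maximalRealSubfield L)) L (IsCMField.complexConj L) 3 (Matrix.diagonal α))]
  [∀ (S : Finset {w : InfinitePlace L // IsComplex w}) (w : {w : InfinitePlace L // IsComplex w}), MeasurableSpace (↥(archLocal L 3 (Matrix.diagonal α) w) ⧸ chartTorusGLoc L α w S)]
  [∀ (S : Finset {w : InfinitePlace L // IsComplex w}) (w : {w : InfinitePlace L // IsComplex w}), BorelSpace (↥(archLocal L 3 (Matrix.diagonal α) w) ⧸ chartTorusGLoc L α w S)]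
  (ν'w : ∀ w : {w : InfinitePlace L // IsComplex w}, Measure ↥(archLocal L 3 (Matrix.diagonal α) w))
  (hαm : ∀ w : {w : InfinitePlace L // IsComplex w}, (ν'w w).IsHaarMeasure ∧ (ν'w w).IsMulRightInvariant)
  (ν' : Measure ↥(arch (↥(maximalRealSubfield L)) L (IsCMField.complexConj L) 3 (Matrix.diagonal α))) [ν'.IsHaarMeasure] [ν'.IsMulRightInvariant]
  (hν : ν' = (Measure.pi ν'w).map (archPiEquivCM 3 L (Matrix.diagonal α)).symm)
  (tα : ∀ (S : Finset {w : InfinitePlace L // IsComplex w}) (w : {w : InfinitePlace L // IsComplex w}), Measure ↥(chartTorusGLoc L α w S))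
  (hαt : ∀ (S : Finset {w : InfinitePlace L // IsComplex w}) (w : {w : InfinitePlace L // IsComplex w}), (tα S w).IsHaarMeasure ∧ (tα S w).IsInvInvariant)
  (p : {w : InfinitePlace L // IsComplex w} → Prop) [DecidablePred p]

include hνβm hνβ htβm hν hαm hαt in
/-- **THE PER-BALL IDENTITY FROM THE SLICES — NO MEASURE-CLASS INSTANCE FAMILY IN SCOPE** (the letter a two-frame consumer binds: the `β`-frame facts `hνβm`∕`htβm` AND the `α`-frame facts
`hαm`∕`hαt` are `And`-packages, read by term-mode `haveI` inside the binders; otherwise `ballIdentity_of_slices` verbatim).  Proof: `haveI` the `β` families, `exact ballIdentity_of_slices`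
(measure classes are `Prop`s — the instance terms are proof-irrelevant). [cite: Rogawski1990, §4.1 (4.1.1) p. 39; §14.2 (14.2.1) pp. 232–233] [cite: Shelstad1979, Lemma 4.2 p. 23] -/
theorem ballIdentity_of_slices_of_and (hα : ∀ i, α i ≠ 0) (hherm : ∀ i, (IsCMField.complexConj L (α i) : L) = α i) (hβ0 : ∀ i, β i ≠ 0)
    (hβsplit : ∀ w : {w : InfinitePlace L // IsComplex w}, w ∈ splitChartPlaces L β) (hp : ∀ w, p w ↔ w ∉ splitChartPlaces L α)
    -- the `α`-side test function and the per-ball `β`-side tensor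
    {a' : ↥(arch (↥(maximalRealSubfield L)) L (IsCMField.complexConj L) 3 (Matrix.diagonal α)) → ℂ} (ha'c : Continuous a') (ha's : HasCompactSupport a')
    {f : ↥(arch (↥(maximalRealSubfield L)) L (IsCMField.complexConj L) 3 (Matrix.diagonal β)) → ℂ} (hfc : Continuous f) (hfs : HasCompactSupport f)
    (mcl : {w : {w : InfinitePlace L // IsComplex w} // p w} → ℂ × ℂ × ℂ → ℂ) (hmclc : ∀ w, Continuous (mcl w))
    (fw : ∀ w : {w : {w : InfinitePlace L // IsComplex w} // p w}, ↥(archLocal L 3 (Matrix.diagonal β) w.1) → ℂ) (hfw : ∀ w, Measurable (fw w))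
    (G : ({w : {w : InfinitePlace L // IsComplex w} // p w} → ℂ × ℂ × ℂ) →
      (∀ w' : {w : {w : InfinitePlace L // IsComplex w} // ¬ p w}, ↥(archLocal L 3 (Matrix.diagonal β) w'.1)) → ℂ)
    (hf : ∀ k, f k = (∏ w : {w : {w : InfinitePlace L // IsComplex w} // p w}, mcl w (bzClassG L β k w.1) * fw w (archPiEquivCM 3 L (Matrix.diagonal β) k w.1)) *
      G (fun w => bzClassG L β k w.1) (fun w' => archPiEquivCM 3 L (Matrix.diagonal β) k w'.1))
    -- the ball data at each definite place: centre, radius, partition factor, generator's `h`; their clauses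
    (b : {w : {w : InfinitePlace L // IsComplex w} // p w} → ℂ × ℂ × ℂ) (ε : {w : {w : InfinitePlace L // IsComplex w} // p w} → ℝ)
    (F : {w : {w : InfinitePlace L // IsComplex w} // p w} → ℂ × ℂ × ℂ → ℝ) (h : {w : {w : InfinitePlace L // IsComplex w} // p w} → ℂ × ℂ × ℂ → ℂ)
    (hmclF : ∀ w z, mcl w z = 2 * ((F w z : ℝ) : ℂ) / h w z)
    (hFε : ∀ w z, F w z ≠ 0 → dist z (b w) < ε w)
    (hh0 : ∀ w z, dist z (b w) < ε w → h w z ≠ 0)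
    (hsplit : ∀ (w : {w : {w : InfinitePlace L // IsComplex w} // p w}) (S' : Finset {w : InfinitePlace L // IsComplex w})
      (c' : {w : InfinitePlace L // IsComplex w} → Fin 3 → ℝ),
      w.1 ∈ S' → c' w.1 0 ≠ 0 → dist (bzClassMapG S' c' w.1) (b w) < ε w →
        (haveI := (hνβm w.1).1; haveI := (hνβm w.1).2; chartOrbGLoc L β w.1 S' (νβw w.1) (fw w) (c' w.1)) = 0)
    (hcpt : ∀ (w : {w : {w : InfinitePlace L // IsComplex w} // p w}) (S' : Finset {w : InfinitePlace L // IsComplex w})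
      (c' : {w : InfinitePlace L // IsComplex w} → Fin 3 → ℝ),
      w.1 ∉ S' → (Function.Injective fun i : Fin 3 => Circle.exp (c' w.1 i)) → dist (bzClassMapG S' c' w.1) (b w) < ε w →
        ∑ σ : Equiv.Perm (Fin 3), (haveI := (hνβm w.1).1; haveI := (hνβm w.1).2; chartOrbGLoc L β w.1 S' (νβw w.1) (fw w) (c' w.1 ∘ σ)) =
          h w (bzClassMapG S' c' w.1))
    -- the block transport, ★ E3-CORE's letter (LHS: ★ hβ's `¬p`-block reading of the coupling; RHS: ★ hα's = ★ (s1)'s summand), quantified over the labels OFF the block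
    (hIT : ∀ (S : Finset {w : InfinitePlace L // IsComplex w}) (c : {w : InfinitePlace L // IsComplex w} → Fin 3 → ℝ), c ∈ RegG S → (∀ w, p w → w ∉ S) →
      (∏ w : {w : {w : InfinitePlace L // IsComplex w} // p w}, ((F w (bzClassMapG S c w.1) : ℝ) : ℂ)) ≠ 0 →
      ∀ ρ₂ ∈ partnerPerms (S.subtype fun w => ¬ p w),
        (∏ w' : {w : {w : InfinitePlace L // IsComplex w} // ¬ p w}, ((tβ S w'.1 (chartBoxImgGLoc L β w'.1 S)).toReal : ℂ)) *
            ∫ b' : (∀ w' : {w : {w : InfinitePlace L // IsComplex w} // ¬ p w}, ↥(archLocal L 3 (Matrix.diagonal β) w'.1) ⧸ chartTorusGLoc L β w'.1 S),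
              G (fun w => bzClassMapG S c w.1)
                (fun w' => descConj (gprimeBlockAt L β w'.1 S (fun i => c w'.1 (ρ₂ w' i))) (chartTorusGLoc L β w'.1 S)
                  (forall_mem_chartTorusGLoc_comm L β w'.1 S (fun i => c w'.1 (ρ₂ w' i))) id (b' w'))
              ∂(Measure.pi fun w' : {w : {w : InfinitePlace L // IsComplex w} // ¬ p w} =>
                  haveI := (htβm S w'.1).1; haveI := (htβm S w'.1).2; haveI := (hνβm w'.1).1; haveI := (hνβm w'.1).2
                  quotientMeasure (chartTorusGLoc L β w'.1 S) (tβ S w'.1) (isClosed_chartTorusGLoc L β w'.1 S) (νβw w'.1)) =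
          (∏ w' : {w : {w : InfinitePlace L // IsComplex w} // ¬ p w}, ((tα S w'.1 (chartBoxImgGLoc L α w'.1 S)).toReal : ℂ)) *
            ∫ b : (∀ w' : {w : {w : InfinitePlace L // IsComplex w} // ¬ p w}, ↥(archLocal L 3 (Matrix.diagonal α) w'.1) ⧸ chartTorusGLoc L α w'.1 S),
              (∫ g : (∀ w : {w : {w : InfinitePlace L // IsComplex w} // p w}, ↥(archLocal L 3 (Matrix.diagonal α) w.1)),
                a' ((archPiEquivCM 3 L (Matrix.diagonal α)).symm
                  ((MeasurableEquiv.piEquivPiSubtypeProd (fun w : {w : InfinitePlace L // IsComplex w} => ↥(archLocal L 3 (Matrix.diagonal α) w)) p).symm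
                    (fun w => g w * gprimeBlockAt L α w.1 S
                        (slotPerm ((Equiv.piEquivPiSubtypeProd p (fun _ : {w : InfinitePlace L // IsComplex w} => Equiv.Perm (Fin 3))).symm (1, ρ₂)) c w.1) * (g w)⁻¹,
                      fun w' => descConj (gprimeBlockAt L α w'.1 S
                          (slotPerm ((Equiv.piEquivPiSubtypeProd p (fun _ : {w : InfinitePlace L // IsComplex w} => Equiv.Perm (Fin 3))).symm (1, ρ₂)) c w'.1))
                        (chartTorusGLoc L α w'.1 S)
                        (forall_mem_chartTorusGLoc_comm L α w'.1 S
                          (slotPerm ((Equiv.piEquivPiSubtypeProd p (fun _ : {w : InfinitePlace L // IsComplex w} => Equiv.Perm (Fin 3))).symm (1, ρ₂)) c w'.1))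
                        id (b w'))))
                ∂(Measure.pi fun w : {w : {w : InfinitePlace L // IsComplex w} // p w} => ν'w w.1))
              ∂(Measure.pi fun w' : {w : {w : InfinitePlace L // IsComplex w} // ¬ p w} =>
                  haveI := (hαt S w'.1).1; haveI := (hαt S w'.1).2; haveI := (hαm w'.1).1; haveI := (hαm w'.1).2
                  quotientMeasure (chartTorusGLoc L α w'.1 S) (tα S w'.1) (isClosed_chartTorusGLoc L α w'.1 S) (ν'w w'.1))) :
    ∀ (S : Finset {w : InfinitePlace L // IsComplex w}) (c : {w : InfinitePlace L // IsComplex w} → Fin 3 → ℝ), c ∈ RegG S →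
      stableSumG (orbFamGExt L β νβ f) S c =
        ((3 : ℂ)⁻¹) ^ Fintype.card {w : {w : InfinitePlace L // IsComplex w} // p w} *
          stableSumG (orbFamGExt L α ν' (fun k => ((∏ v : {w : {w : InfinitePlace L // IsComplex w} // p w}, F v (bzClassG L α k v.1) : ℝ) : ℂ) * a' k)) S c := by
  haveI : ∀ w : {w : InfinitePlace L // IsComplex w}, (νβw w).IsHaarMeasure := fun w => (hνβm w).1
  haveI : ∀ w : {w : InfinitePlace L // IsComplex w}, (νβw w).IsMulRightInvariant := fun w => (hνβm w).2
  haveI : ∀ (S : Finset {w : InfinitePlace L // IsComplex w}) (w : {w : InfinitePlace L // IsComplex w}), (tβ S w).IsHaarMeasure := fun S w => (htβm S w).1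
  haveI : ∀ (S : Finset {w : InfinitePlace L // IsComplex w}) (w : {w : InfinitePlace L // IsComplex w}), (tβ S w).IsInvInvariant := fun S w => (htβm S w).2
  exact ballIdentity_of_slices L α β νβw νβ hνβ tβ ν'w hαm ν' hν tα hαt p hα hherm hβ0 hβsplit hp ha'c ha's hfc hfs mcl hmclc fw hfw G hf b ε F h
    hmclF hFε hh0 hsplit hcpt hIT

end BallIdentityAnd

end Literature.NumberTheory.Rogawski1990

end
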